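import Literature.NumberTheory.LFunctions.GeneralizedBernoulliNumbers
import Mathlib.NumberTheory.BernoulliPolynomials
import Mathlib.RingTheory.PowerSeries.Exp
import Mathlib.RingTheory.PowerSeries.Inverse
import HarnessLib

/-!
# The generating function of the generalized Bernoulli numbers

Topic `Literature/NumberTheory/LFunctions`; namespace `Literature.NumberTheory.LFunctions`.
THEOREMS ONLY (auxiliary `def`s with bodies; no named facts).

For a Dirichlet character `χ` modulo `N` with values in a commutative `ℚ`-algebra `R`, the tree's
generalized Bernoulli numbers `B_{k,χ} = N^{k-1} ∑_{c=0}^{N-1} χ(c) B_k(c/N)` (Diamond–Shurman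
(4.30), `generalizedBernoulli`) have the exponential generating function (op. cit. (4.29))
`(∑_k B_{k,χ} t^k/k!) · (e^{Nt} - 1) = ∑_{c=0}^{N-1} χ(c) t e^{ct}`
(`genBernoulliSeries_mul_exp_sub_one`, from Mathlib's `Polynomial.bernoulli_generating_function`).
Consequence: `B_{k,χ}` only depends on the `N`-periodic function `c ↦ χ(c)` — it is unchanged under
a change of level that does not change the function (`generalizedBernoulli_eq_of_apply_cast_eq`,
`generalizedBernoulli_changeLevel_of_primeFactors_subset`).

## References

* F. Diamond, J. Shurman, *A First Course in Modular Forms*, GTM 228 (2005), §4.7, (4.29)–(4.30),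
  p. 135. [DiamondShurman2005]
* L. C. Washington, *Introduction to Cyclotomic Fields*, 2nd ed., GTM 83 (1997), §4.1. [Washington1997]
-/

noncomputable section

open Finset PowerSeries

namespace Literature.NumberTheory.LFunctions

variable {R : Type*} [CommRing R] [Algebra ℚ R] {N : ℕ} [NeZero N]

/-- The exponential generating series `∑_k B_{k,χ} t^k/k!` of the generalized Bernoulli numbers.
[cite: DiamondShurman2005, §4.7 (4.29)] -/
def genBernoulliSeries (χ : DirichletCharacter R N) : R⟦X⟧ :=
  PowerSeries.mk fun k ↦ algebraMap ℚ R (1 / k.factorial : ℚ) * generalizedBernoulli k χ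

/-- Coefficients of `genBernoulliSeries`. [folklore] -/
theorem coeff_genBernoulliSeries (χ : DirichletCharacter R N) (k : ℕ) :
    coeff k (genBernoulliSeries χ) = algebraMap ℚ R (1 / k.factorial : ℚ) * generalizedBernoulli k χ := by
  rw [genBernoulliSeries, coeff_mk]

omit [NeZero N] in
/-- `N · (N^{k-1} B_k(c/N)) = N^k B_k(c/N)` (also for `k = 0`, where the weight is `N^{-1}`). [folklore] -/
theorem natCast_mul_genBernoulliCoeff (hN : N ≠ 0) (k c : ℕ) :
    (N : ℚ) * genBernoulliCoeff k N c = (N : ℚ) ^ k * (Polynomial.bernoulli k).eval ((c : ℚ) / N) := by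
  unfold genBernoulliCoeff
  rw [← mul_assoc]
  congr 1
  have hN' : (N : ℚ) ≠ 0 := Nat.cast_ne_zero.mpr hN
  rw [← zpow_one_add₀ hN', add_sub_cancel, zpow_natCast]

/-- Rescaling Mathlib's generating function of the Bernoulli polynomials:
`B(t; aX) · (e^{aX} - 1) = aX e^{taX}`. [folklore] -/
theorem rescale_bernoulli_generating_function (t a : R) :
    rescale a (PowerSeries.mk fun n ↦ Polynomial.aeval t ((1 / n.factorial : ℚ) • Polynomial.bernoulli n)) *
        (rescale a (exp R) - 1) = C a * X * rescale (t * a) (exp R) := by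
  have h := congrArg (rescale a) (Polynomial.bernoulli_generating_function t)
  rw [map_mul, map_sub, map_one, map_mul, rescale_X, rescale_rescale] at h
  exact h

/-- **The generating function of the generalized Bernoulli numbers** (Diamond–Shurman (4.29)):
`(∑_k B_{k,χ} t^k/k!) (e^{Nt} - 1) = ∑_{c=0}^{N-1} χ(c) t e^{ct}`.
[cite: DiamondShurman2005, §4.7 (4.29)–(4.30)] -/
theorem genBernoulliSeries_mul_exp_sub_one (χ : DirichletCharacter R N) :
    genBernoulliSeries χ * (rescale (N : R) (exp R) - 1) =
      ∑ j : ZMod N, C (χ j) * (X * rescale (j.val : R) (exp R)) := by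
  have hN0 : N ≠ 0 := NeZero.ne N
  have hNQ : (N : ℚ) ≠ 0 := Nat.cast_ne_zero.mpr hN0
  have hN : IsUnit (N : R) := by
    rw [← map_natCast (algebraMap ℚ R) N]
    exact (isUnit_iff_ne_zero.mpr hNQ).map _
  -- `C N · genBernoulliSeries χ = ∑_j χ(j) · rescale N (B(j/N; X))`
  have key : C (N : R) * genBernoulliSeries χ =
      ∑ j : ZMod N, C (χ j) * rescale (N : R)
        (PowerSeries.mk fun n ↦ Polynomial.aeval (algebraMap ℚ R ((j.val : ℚ) / N))
          ((1 / n.factorial : ℚ) • Polynomial.bernoulli n)) := by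
    ext n
    simp only [coeff_C_mul, coeff_genBernoulliSeries, map_sum, rescale_mk, coeff_mk,
      generalizedBernoulli_eq_sum, mul_sum]
    refine sum_congr rfl fun j _ ↦ ?_
    rw [map_smul, Polynomial.aeval_algebraMap_apply_eq_algebraMap_eval, Algebra.smul_def,
      ← map_natCast (algebraMap ℚ R) N]
    -- both sides are `χ j` times an image of a rational number
    have : (N : ℚ) * ((1 / n.factorial : ℚ) * genBernoulliCoeff n N j.val) =
        (N : ℚ) ^ n * ((1 / n.factorial : ℚ) * (Polynomial.bernoulli n).eval ((j.val : ℚ) / N)) := by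
      rw [mul_left_comm, natCast_mul_genBernoulliCoeff hN0, mul_left_comm]
    calc algebraMap ℚ R N * (algebraMap ℚ R (1 / n.factorial) * (χ j * algebraMap ℚ R (genBernoulliCoeff n N j.val)))
        = χ j * algebraMap ℚ R ((N : ℚ) * ((1 / n.factorial : ℚ) * genBernoulliCoeff n N j.val)) := by
          rw [map_mul, map_mul]; ring
      _ = χ j * (algebraMap ℚ R N ^ n * (algebraMap ℚ R (1 / n.factorial) *
            algebraMap ℚ R ((Polynomial.bernoulli n).eval ((j.val : ℚ) / N)))) := by
          rw [this, map_mul, map_mul, map_pow]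
  refine hN.map C |>.mul_left_cancel ?_
  rw [← mul_assoc, key, sum_mul, mul_sum]
  refine sum_congr rfl fun j _ ↦ ?_
  rw [mul_assoc, rescale_bernoulli_generating_function]
  have hj : algebraMap ℚ R ((j.val : ℚ) / N) * N = (j.val : R) := by
    rw [← map_natCast (algebraMap ℚ R) N, ← map_mul, div_mul_cancel₀ _ hNQ, map_natCast]
  rw [hj]
  ring

/-- **`B_{k,χ}` only depends on the periodic function `c ↦ χ(c)`**: if `N ∣ N'` and `χ'` modulo `N'`
agrees with `χ` modulo `N` as a function, then `B_{k,χ'} = B_{k,χ}` (`R` a domain).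
[cite: Washington1997, §4.1 (remark after the definition of `B_{n,χ}`)] -/
theorem generalizedBernoulli_eq_of_apply_cast_eq [IsDomain R] {N' : ℕ} [NeZero N'] (h : N ∣ N')
    (χ : DirichletCharacter R N) (χ' : DirichletCharacter R N')
    (hχ : ∀ a : ZMod N', χ' a = χ (ZMod.cast a : ZMod N)) (k : ℕ) :
    generalizedBernoulli k χ' = generalizedBernoulli k χ := by
  classical
  obtain ⟨d, hd⟩ := h
  have hd0 : d ≠ 0 := by rintro rfl; exact NeZero.ne N' (by rw [hd, mul_zero])
  have hN0 : N ≠ 0 := NeZero.ne N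
  have hNu : IsUnit (N : R) := by
    rw [← map_natCast (algebraMap ℚ R) N]
    exact (isUnit_iff_ne_zero.mpr (Nat.cast_ne_zero.mpr hN0 : (N : ℚ) ≠ 0)).map _
  have hdu : IsUnit (d : R) := by
    rw [← map_natCast (algebraMap ℚ R) d]
    exact (isUnit_iff_ne_zero.mpr (Nat.cast_ne_zero.mpr hd0 : (d : ℚ) ≠ 0)).map _
  -- the two generating functions against `e^{N't} - 1 = (e^{Nt} - 1) U`
  set U : R⟦X⟧ := ∑ i ∈ range d, (rescale (N : R) (exp R)) ^ i with hU
  have hfac : rescale (N' : R) (exp R) - 1 = (rescale (N : R) (exp R) - 1) * U := by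
    rw [hU, mul_comm, geom_sum_mul, ← exp_pow_eq_rescale_exp, ← exp_pow_eq_rescale_exp, ← pow_mul, ← hd]
  -- the right-hand sides: `∑_{j' mod N'} χ'(j') X e^{j' t} = (∑_{j mod N} χ(j) X e^{j t}) U`
  set F : ℕ → R⟦X⟧ := fun v ↦ C (χ (v : ZMod N)) * (X * rescale (v : R) (exp R)) with hF
  have hrhs' : ∑ j' : ZMod N', C (χ' j') * (X * rescale (j'.val : R) (exp R)) = ∑ v ∈ range N', F v := by
    refine Finset.sum_nbij (fun j' : ZMod N' ↦ j'.val) (fun j' _ ↦ mem_range.mpr (ZMod.val_lt j'))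
      (fun a _ b _ h ↦ ZMod.val_injective N' h) (fun v hv ↦ ?_) (fun j' _ ↦ ?_)
    · rw [Finset.mem_coe, mem_range] at hv
      exact ⟨(v : ZMod N'), Finset.mem_coe.mpr (mem_univ _), ZMod.val_natCast_of_lt hv⟩
    · simp only [hF, hχ j', ZMod.cast_eq_val]
  have hrhs : ∑ j : ZMod N, C (χ j) * (X * rescale (j.val : R) (exp R)) = ∑ v ∈ range N, F v := by
    refine Finset.sum_nbij (fun j : ZMod N ↦ j.val) (fun j _ ↦ mem_range.mpr (ZMod.val_lt j))
      (fun a _ b _ h ↦ ZMod.val_injective N h) (fun v hv ↦ ?_) (fun j _ ↦ ?_)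
    · rw [Finset.mem_coe, mem_range] at hv
      exact ⟨(v : ZMod N), Finset.mem_coe.mpr (mem_univ _), ZMod.val_natCast_of_lt hv⟩
    · simp only [hF, ZMod.natCast_zmod_val]
  have hFshift : ∀ i v, F (N * i + v) = F v * (rescale (N : R) (exp R)) ^ i := by
    intro i v
    simp only [hF]
    have h1 : ((N * i + v : ℕ) : ZMod N) = (v : ZMod N) := by
      push_cast; rw [ZMod.natCast_self, zero_mul, zero_add]
    have h2 : rescale ((N * i + v : ℕ) : R) (exp R) = rescale (v : R) (exp R) * rescale (N : R) (exp R) ^ i := by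
      rw [← exp_pow_eq_rescale_exp N, ← pow_mul, exp_pow_eq_rescale_exp, exp_mul_exp_eq_exp_add]
      congr 1; push_cast; ring
    rw [h1, h2]; ring
  have hsplit : ∀ e : ℕ, ∑ v ∈ range (N * e), F v =
      (∑ v ∈ range N, F v) * ∑ i ∈ range e, (rescale (N : R) (exp R)) ^ i := by
    intro e
    induction e with
    | zero => rw [mul_zero, sum_range_zero, sum_range_zero, mul_zero]
    | succ e ih =>
      rw [Nat.mul_succ, sum_range_add, ih, sum_range_succ, mul_add]
      congr 1
      rw [sum_mul]
      exact sum_congr rfl fun v _ ↦ hFshift e v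
  have h1 := genBernoulliSeries_mul_exp_sub_one χ'
  have h2 := genBernoulliSeries_mul_exp_sub_one χ
  rw [hrhs'] at h1
  have h3 : genBernoulliSeries χ' * (rescale (N : R) (exp R) - 1) * U =
      genBernoulliSeries χ * (rescale (N : R) (exp R) - 1) * U := by
    calc genBernoulliSeries χ' * (rescale (N : R) (exp R) - 1) * U
        = genBernoulliSeries χ' * (rescale (N' : R) (exp R) - 1) := by rw [hfac, mul_assoc]
      _ = ∑ v ∈ range N', F v := h1
      _ = (∑ v ∈ range N, F v) * U := by rw [hd, hsplit d, hU]
      _ = genBernoulliSeries χ * (rescale (N : R) (exp R) - 1) * U := by rw [h2, hrhs]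
  -- cancel the non-zero factors `U` and `e^{Nt} - 1`
  have hU0 : U ≠ 0 := by
    intro h0
    have := congrArg constantCoeff h0
    rw [hU, map_sum, map_zero] at this
    simp only [map_pow, ← exp_pow_eq_rescale_exp, constantCoeff_exp, one_pow, sum_const, card_range,
      nsmul_eq_mul, mul_one] at this
    exact hdu.ne_zero this
  have hE0 : rescale (N : R) (exp R) - 1 ≠ 0 := by
    intro h0
    have := congrArg (coeff 1) h0
    rw [map_sub, coeff_rescale, coeff_exp, pow_one, Nat.factorial_one, Nat.cast_one, div_one, map_one,
      mul_one, coeff_one, if_neg one_ne_zero, sub_zero, map_zero] at this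
    exact hNu.ne_zero this
  have hG : genBernoulliSeries χ' = genBernoulliSeries χ :=
    mul_right_cancel₀ hE0 (mul_right_cancel₀ hU0 h3)
  have hk := congrArg (coeff k) hG
  rw [coeff_genBernoulliSeries, coeff_genBernoulliSeries] at hk
  have hfu : IsUnit (algebraMap ℚ R (1 / k.factorial : ℚ)) :=
    (isUnit_iff_ne_zero.mpr (one_div_ne_zero (Nat.cast_ne_zero.mpr k.factorial_ne_zero))).map _
  exact hfu.mul_left_cancel hk

/-- In particular `B_{k, changeLevel χ} = B_{k,χ}` when the new level `N'` has no prime factor outside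
those of `N` (so that `changeLevel` does not change the function `c ↦ χ(c)`).
[cite: Washington1997, §4.1] -/
theorem generalizedBernoulli_changeLevel [IsDomain R] {N' : ℕ} [NeZero N'] (h : N ∣ N')
    (hprimes : ∀ ℓ : ℕ, ℓ.Prime → ℓ ∣ N' → ℓ ∣ N) (χ : DirichletCharacter R N) (k : ℕ) :
    generalizedBernoulli k (DirichletCharacter.changeLevel h χ) = generalizedBernoulli k χ := by
  refine generalizedBernoulli_eq_of_apply_cast_eq h χ _ (fun a ↦ ?_) k
  by_cases ha : IsUnit a
  · obtain ⟨u, rfl⟩ := ha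
    exact DirichletCharacter.changeLevel_eq_cast_of_dvd χ h u
  · rw [MulChar.map_nonunit _ ha, MulChar.map_nonunit]
    -- `cast a` is not a unit modulo `N` either
    intro hu
    apply ha
    rw [← ZMod.natCast_zmod_val a, ZMod.isUnit_iff_coprime]
    rw [ZMod.cast_eq_val, ZMod.isUnit_iff_coprime] at hu
    exact Nat.coprime_of_dvd fun ℓ hℓ hℓa hℓN' ↦ hℓ.one_lt.ne' (Nat.eq_one_of_dvd_coprimes hu hℓa (hprimes ℓ hℓ hℓN'))

end Literature.NumberTheory.LFunctions
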